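import Mathlib.Analysis.Normed.Module.Ball.Pointwise
import Mathlib.Analysis.SpecialFunctions.Complex.Log
import Mathlib.Topology.MetricSpace.Ultra.Basic
import Mathlib.Topology.MetricSpace.ProperSpace
import Mathlib.GroupTheory.Torsion
import Mathlib.GroupTheory.QuotientGroup.Defs
import Literature.AnabelianGeometry.AbsoluteAnabelian.LogShells
import Literature.AnabelianGeometry.AbsoluteAnabelian.LocalVolumesNonarchimedean
import Literature.IUT.LogThetaLattice.LocalLogShells
import HarnessLib

/-!
# [IUTchIII] Proposition 1.2 (ii)–(ix) and Definition 1.1 (iv)–(vi) at one place `v`, over the [AbsTopIII] log-shell files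

Mochizuki, *Inter-universal Teichmüller Theory III*, kurims manuscript (May 2020), §1, Def 1.1 (iv)–(vi)
pp.27–28 and Prop 1.2 (ii)–(ix) pp.31–34 (D-0012 claim key, status disputed; every decl carries
`[claim: Mochizuki2012, status: disputed]`; the concrete facts proved are classical local-field facts
and take no side). Written per L6 ruling R6 (2026-08-25T18:37Z): NO local log-shell interface — the
nonarchimedean log-shell is `Literature.AnabelianGeometry.AbsoluteAnabelian.logShell L` over L4-t3's
hypothesis structure `PadicLogOnUnits K` ([AbsTopIII] Def 5.4 (iii), p403899), the log-volumes are
`localLogVolume K` / `LogVolumeCompatible` ([AbsTopIII] Prop 5.7 (i), L4-t3), the archimedean shell is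
`ComplexLogShell.logShell = closedBall 0 π` (L4-t3) and `arcLogShell` (this seat's `LocalLogShells.lean`),
and the mono-analytic log-volume is `MLFType.logShellLogVolume` ([AbsTopIII] Prop 5.8 (iii), L4-t3).

Printed text (Prop 1.2, pp.31–34; `(∗non)`: `Ψ_{†F_v} ⊇ Ψ^×_{†F_v} → log(†F_v) = Ψ^{gp}_{log(†F_v)} ⥲ Ψ^{gp}_{‡F_v}`).
* (ii) "At `v ∈ V̲^{non}`, the natural `†Π_v`-actions on the "Ψ's" appearing in the diagram (∗non) are
  compatible with the ind-topological ring structures on `Ψ^{gp}_{†F_v}` and `Ψ^{gp}_{log(†F_v)}`."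
* (iii) "At `v ∈ V̲^{non}`, the diagram (∗non) is compatible with the natural `p_v`-adic log-volumes [cf.
  [AbsTopIII], Proposition 5.7, (i), (c); Corollary 5.10, (ii)] on the subsets of `†Π_v`-invariants of
  `Ψ^{gp}_{†F_v}` and `Ψ^{gp}_{log(†F_v)}`." (archimedean: angular vs radial log-volume).
* (iv) "The Kummer isomorphisms `Ψ_cns(†F) ⥲ Ψ_cns(†D)`; `Ψ_cns(‡F) ⥲ Ψ_cns(‡D)` … fail to be compatible
  with the [poly-]isomorphism `Ψ_cns(†D) ⥲ Ψ_cns(‡D)` of (i), relative to the diagrams (∗non), (∗arc)".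
* (v) "(a^{non}) `I_{†F_v}` is compact, hence of finite log-volume; (b^{non}) `I_{†F_v}` contains the submonoid
  of `†Π_v`-invariants of `Ψ_{log(†F_v)}`; (c^{non}) `I_{†F_v}` contains the image of the submonoid of
  `†Π_v`-invariants of `Ψ^×_{†F_v}`"; (a^{arc}) compact; (b^{arc}) `I_{†F_v} ⊇ Ψ_{log(†F_v)}`; (c^{arc}) the image of
  `I_{†F_v}` contains `Ψ^×_{†F_v}` — i.e. [Rmk 1.2.2] `O_k^▷ ⊆ O_k ⊆ I_k`, `log_k(O_k^×) ⊆ I_k`, `O_k^× ⊆ exp_k(I_k)`.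
* (vi)/(vii) mono-analytic log-shells `I_{†D^⊢_v} := I(†G_v) ⊆ k^∼(†G_v) =: log(†D^⊢_v)` "equipped with a
  `p_v`-adic log-volume" [AbsTopIII Prop 5.8], and functorial isomorphisms `log(†D^⊢_v) ⥲ log(†F^{⊢×μ}_v) ⥲
  log(†F_v)` "compatible with … the respective log-shells, and the respective log-volumes".
* (viii) the collections of these over `v ∈ V̲`; (ix) coric holomorphic log-shells `I_{*D} := I_{F(*D)}`.
* Def 1.1 (iv) p.27: the construction of `I_{†F_v} ⊆ log(†F_v)` "only require[s] the perfection "`(−)^{pf}`" of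
  the units and [is] manifestly unaffected by the operation of forming the quotient by a torsion subgroup
  of the units" — so it is an object constructed from `†F^{⊢×μ}_v`; (v) archimedean analogue; (vi) the
  collections `I_{†F^{⊢×μ}} ⊆ log(†F^{⊢×μ})`.

What is PROVED here (model level, one `v`): (iv) `log_ne_self_of_mem_principalUnits` — the logarithm
is not the identity on any principal unit (its values there have norm `< 1`), the concrete shadow of the
non-commutativity of the Kummer arrows with the coricity arrow; (v) (a^{non}) `isCompact_logShell` (given
continuity of the logarithm on the units and properness), (b^{non}) = L4-t3's `closedBall_subset_logShell`
re-cited with `nonzeroIntegers ⊆ 𝒪`, (c^{non}) `preLogShell_subset_logShell` (given the power rule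
`log(x^{p*}) = p*·log x`), (a^{arc})(b^{arc})(c^{arc}) from `ComplexLogShell` + `LocalLogShells`;
Def 1.1 (iv) `logModTorsion` — a logarithm that is a homomorphism on the units FACTORS through the
quotient by the torsion subgroup (`log` kills roots of unity). STATED as predicates with explicit
arguments (inputs owned by abc-iut-S1 / abc-iut-L4-t3, TODO-merge): (iii) `LogLinkVolumeCompatible`
(= L4-t3's `LogVolumeCompatible L.log` together with volume preservation by the identification with the
codomain), (vi) `HolMonoVolumeCompatible` (`μ^{log}(I_k) = MLFType.logShellLogVolume`, [AbsTopIII] Prop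
5.8 (iii)). (ii), (vii)–(ix) are packagings with no numerical content beyond the above at one `v`; their
strip-level functorial form is `BiCores.lean` (Thm 1.5 (iii)–(v) likewise).
-/

noncomputable section

namespace Literature.IUT.LogThetaLattice

open Set Metric Complex
open scoped Pointwise Real
open Literature.AnabelianGeometry.AbsoluteAnabelian

/-! ### Nonarchimedean `v`: the model `(K, log_k, p*)` of L4-t3's `PadicLogOnUnits` -/

section Nonarchimedean

variable {K : Type*} [NontriviallyNormedField K] (L : PadicLogOnUnits K)

/-- **IUTchIII:Prop1.2(iv)** (kurims p.31) concrete shadow of "the Kummer isomorphisms … fail to be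
compatible with the [coricity] poly-isomorphism … relative to (∗non)": the shell-arrow `log_k` is NOT the
identity on the units — on every principal unit `x ∈ 1 + p*·𝒪_k` one has `‖log_k x‖ ≤ ‖p*‖ < 1 = ‖x‖`, so
`log_k x ≠ x`. [claim: Mochizuki2012, status: disputed] -/
theorem log_ne_self_of_mem_principalUnits [IsUltrametricDist K] {x : K}
    (hx : x ∈ closedBall (1 : K) ‖L.pstar‖) : L.log x ≠ x := by
  have hlog : L.log x ∈ closedBall (0 : K) ‖L.pstar‖ := by
    rw [← L.image_principalUnits]; exact mem_image_of_mem _ hx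
  have hxu : ‖x‖ = 1 := by simpa using closedBall_one_subset_sphere L hx
  intro h
  rw [h, mem_closedBall, dist_zero_right, hxu] at hlog
  exact absurd hlog (not_le.mpr L.norm_pstar_lt_one)

/-- **IUTchIII:Prop1.2(iv)** (kurims p.31) in particular `log_k 1 ≠ 1`: the diagram `𝒪^× → log(†F_v) ⥲ ‡`
versus the Kummer identification of units does not commute already at `1`. [claim: Mochizuki2012, status: disputed] -/
theorem log_one_ne_one [IsUltrametricDist K] : L.log 1 ≠ 1 :=
  log_ne_self_of_mem_principalUnits L (mem_closedBall_self (norm_nonneg _))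

/-- **IUTchIII:Prop1.2(v)** (kurims p.31) (a^{non}) "`I_{†F_v}` is compact" — for the model
`I_k = (p*)⁻¹ · log_k(𝒪_k^×)`, given that `log_k` is continuous on the (compact) unit sphere of the proper
field `K`. [claim: Mochizuki2012, status: disputed] -/
theorem isCompact_logShell [ProperSpace K] (hcont : ContinuousOn L.log (sphere (0 : K) 1)) :
    IsCompact (logShell L) :=
  ((isCompact_sphere (0 : K) 1).image_of_continuousOn hcont).smul L.pstar⁻¹

/-- **IUTchIII:Prop1.2(v)** (kurims p.31) (a^{non}) "… hence of finite log-volume": a compact set has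
finite normalised Haar measure (`μ_k`, [AbsTopIII] Prop 5.7 (i)). [claim: Mochizuki2012, status: disputed] -/
theorem localHaar_logShell_lt_top [IsUltrametricDist K] [ProperSpace K] [MeasurableSpace K] [BorelSpace K]
    (hcont : ContinuousOn L.log (sphere (0 : K) 1)) : localHaar K (logShell L) < ⊤ :=
  (isCompact_logShell L hcont).measure_lt_top

/-- **IUTchIII:Prop1.2(v)** (kurims pp.31–32) (b^{non}) "`I_{†F_v}` contains the submonoid of
`†Π_v`-invariants of `Ψ_{log(†F_v)}`", i.e. `O_k^▷ ⊆ O_k ⊆ I_k` [Rmk 1.2.2 (i)] — L4-t3's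
`closedBall_subset_logShell` ([AbsTopIII] Def 5.4 (iii), PROVED there from `log : 1 + p*𝒪 ⥲ p*𝒪`).
[claim: Mochizuki2012, status: disputed] -/
theorem nonzeroIntegers_subset_logShell' [IsUltrametricDist K] :
    {a : K | ‖a‖ ≤ 1 ∧ a ≠ 0} ⊆ logShell L := fun a ha =>
  closedBall_subset_logShell L (by simpa [mem_closedBall, dist_zero_right] using ha.1)

/-- **IUTchIII:Prop1.2(v)** (kurims p.32) (c^{non}) "`I_{†F_v}` contains the image of the submonoid of
`†Π_v`-invariants of `Ψ^×_{†F_v}`", i.e. `log_k(𝒪_k^×) ⊆ I_k` — given the power rule `log_k(x^n) = n·log_k(x)`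
on units with `n = p*` (a property of the genuine `p`-adic logarithm; TODO-merge: abc-iut-S1 `unitLog`).
[claim: Mochizuki2012, status: disputed] -/
theorem preLogShell_subset_logShell (n : ℕ) (hn : (n : K) = L.pstar)
    (hpow : ∀ x ∈ sphere (0 : K) 1, L.log (x ^ n) = n * L.log x) : preLogShell L ⊆ logShell L := by
  rintro _ ⟨x, hx, rfl⟩
  have hxn : x ^ n ∈ sphere (0 : K) 1 := by
    rw [mem_sphere, dist_zero_right] at hx ⊢; rw [norm_pow, hx, one_pow]
  refine ⟨L.log (x ^ n), ⟨x ^ n, hxn, rfl⟩, ?_⟩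
  show L.pstar⁻¹ • L.log (x ^ n) = L.log x
  rw [smul_eq_mul, hpow x hx, hn, ← mul_assoc, inv_mul_cancel₀ L.pstar_ne_zero, one_mul]

/-- **IUTchIII:Def1.1(i)** (kurims p.24) dictionary with this seat's `LocalLogShells.lean`: L4-t3's `pstar`
of an `MLFType` is `pStar` of its residue characteristic. [claim: Mochizuki2012, status: disputed] -/
theorem MLFType_pstar_eq_pStar (t : MLFType) : t.pstar = pStar t.p := by
  rw [MLFType.pstar, pStar]
  by_cases h : t.p = 2
  · simp [h]
  · rw [if_neg h, if_neg]
    exact fun he => h ((Nat.Prime.even_iff t.prime_p).mp he)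

/-! ### Prop 1.2 (iii), (vi): the log-volume compatibilities as predicates on the inputs -/

/-- **IUTchIII:Prop1.2(iii)** (kurims p.31) "the diagram (∗non) is compatible with the natural `p_v`-adic
log-volumes [cf. [AbsTopIII], Proposition 5.7, (i), (c); Corollary 5.10, (ii)]": (1) `log_k` is log-volume
compatible in the sense of [AbsTopIII] Prop 5.7 (i)(c) (L4-t3's `LogVolumeCompatible`), and (2) the
identification `log(†F_v) ⥲ Ψ^{gp}_{‡F_v}` with the codomain — here an isometric field isomorphism `e` — preserves
`μ^{log}` on compact open sets. Predicate on the inputs (TODO-merge: abc-iut-S1 for (1)).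
[claim: Mochizuki2012, status: disputed] -/
def LogLinkVolumeCompatible [IsUltrametricDist K] [ProperSpace K] [MeasurableSpace K] [BorelSpace K]
    {K' : Type*} [NontriviallyNormedField K'] [IsUltrametricDist K'] [ProperSpace K'] [MeasurableSpace K']
    [BorelSpace K'] (L : PadicLogOnUnits K) (e : K ≃+* K') : Prop :=
  LogVolumeCompatible L.log ∧ ∀ A ∈ compactOpens K, localLogVolume K' (e '' A) = localLogVolume K A

/-- **IUTchIII:Prop1.2(iii)** (kurims p.31) consequence: under `LogLinkVolumeCompatible`, for a compact open
`A ⊆ 𝒪_k^×` on which `log_k` is injective with compact open image, the log-volume of `A` (domain of the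
log-link) equals the log-volume of its image in the CODOMAIN `‡F_v`. [claim: Mochizuki2012, status: disputed] -/
theorem localLogVolume_logLink [IsUltrametricDist K] [ProperSpace K] [MeasurableSpace K] [BorelSpace K]
    {K' : Type*} [NontriviallyNormedField K'] [IsUltrametricDist K'] [ProperSpace K'] [MeasurableSpace K']
    [BorelSpace K'] {e : K ≃+* K'} (h : LogLinkVolumeCompatible L e)
    {A : Set K} (hA : A ∈ compactOpens K) (hAu : A ⊆ {x : K | ‖x‖ = 1}) (hinj : InjOn L.log A)
    (himg : L.log '' A ∈ compactOpens K) :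
    localLogVolume K' (e '' (L.log '' A)) = localLogVolume K A := by
  rw [h.2 _ himg, ← h.1 A hA hAu hinj himg]

/-- **IUTchIII:Prop1.2(vi)** (kurims p.32) "the various isomorphisms `log(†D^⊢_v) ⥲ log(†F^{⊢×μ}_v) ⥲ log(†F_v)`
… are compatible with … the respective log-shells, and the respective log-volumes": numerically, the
log-volume of the holomorphic log-shell `I_k` equals the mono-analytic value
`μ^{log}(I(G_k)) = (-1 - m/f + e·log(p*)/log p)·f·log p` of [AbsTopIII] Prop 5.8 (iii) (L4-t3's
`MLFType.logShellLogVolume`). Predicate on the inputs (its proof for the genuine `log_k` is the index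
computation `[I_k : 𝒪_k]`; owner L4-t3/S1, TODO-merge). [claim: Mochizuki2012, status: disputed] -/
def HolMonoVolumeCompatible [IsUltrametricDist K] [ProperSpace K] [MeasurableSpace K] [BorelSpace K]
    (L : PadicLogOnUnits K) (t : MLFType) : Prop :=
  localLogVolume K (logShell L) = t.logShellLogVolume

end Nonarchimedean

/-! ### Def 1.1 (iv): the shell only needs the units modulo torsion -/

section ModTorsion

variable {k : Type*} [Field k] [CharZero k] (O : ValuationSubring k) (logk : Additive (↥O)ˣ →+ k)

/-- **IUTchIII:Def1.1(iv)** (kurims p.27) "these constructions only require the perfection "`(−)^{pf}`" of the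
units and are manifestly unaffected by the operation of forming the quotient by a torsion subgroup of the
units": a logarithm that is a homomorphism on `𝒪_k^×` kills every root of unity (`LocalLogShells`:
`log_eq_zero_of_isOfFinOrder`), hence FACTORS through `𝒪_k^× / (torsion) = 𝒪_k^{×μ}`.
[claim: Mochizuki2012, status: disputed] -/
def logModTorsion :
    Additive (↥O)ˣ ⧸ AddCommGroup.torsion (Additive (↥O)ˣ) →+ k :=
  QuotientAddGroup.lift _ logk fun x hx => by
    rw [AddMonoidHom.mem_ker]
    have hx' : IsOfFinOrder (Additive.toMul x) := (isOfFinAddOrder_ofMul_iff).mp hx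
    exact log_eq_zero_of_isOfFinOrder O logk (Additive.toMul x) hx'

/-- **IUTchIII:Def1.1(iv)** (kurims p.27) the factorisation computes the same values: `log^{×μ}([x]) = log x`.
[claim: Mochizuki2012, status: disputed] -/
@[simp] theorem logModTorsion_mk (x : Additive (↥O)ˣ) :
    logModTorsion O logk (QuotientAddGroup.mk x) = logk x :=
  QuotientAddGroup.lift_mk _ _ _

/-- **IUTchIII:Def1.1(iv)** (kurims p.27) hence the log-shell `I_k = (p*)⁻¹·log_k(𝒪_k^×)` of `LocalLogShells`
is determined by `𝒪_k^{×μ}`: it is the image of the factored map. [claim: Mochizuki2012, status: disputed] -/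
theorem nonarchLogShell_eq_range_modTorsion (p : ℕ) :
    nonarchLogShell O logk p =
      Set.range fun q : Additive (↥O)ˣ ⧸ AddCommGroup.torsion (Additive (↥O)ˣ) =>
        ((pStar p : ℕ) : k)⁻¹ * logModTorsion O logk q := by
  ext a
  constructor
  · rintro ⟨x, rfl⟩
    exact ⟨QuotientAddGroup.mk (Additive.ofMul x), by simp only [logModTorsion_mk]⟩
  · rintro ⟨q, rfl⟩
    induction q using QuotientAddGroup.induction_on with
    | H x => exact ⟨Additive.toMul x, by simp only [logModTorsion_mk]; rfl⟩

end ModTorsion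

/-! ### Archimedean `v`: (a^{arc}), (b^{arc}), (c^{arc}) from L4-t3's `ComplexLogShell` and `LocalLogShells` -/

/-- **IUTchIII:Def1.1(ii)** (kurims p.26) dictionary: this seat's `arcLogShell = {‖a‖ ≤ π}` is L4-t3's
`ComplexLogShell.logShell` ([AbsTopIII] Def 5.4 (v), `= closedBall 0 π`). [claim: Mochizuki2012, status: disputed] -/
theorem arcLogShell_eq_complexLogShell : arcLogShell = ComplexLogShell.logShell := by
  rw [ComplexLogShell.logShell_eq_closedBall]
  ext a; simp [arcLogShell, mem_closedBall, dist_zero_right]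

/-- **IUTchIII:Prop1.2(v)** (kurims p.32) (a^{arc}) "`I_{†F_v}` is compact, hence of finite radial
log-volume" (radial log-volume `= log π`, L4-t3's `ComplexLogShell.logShellRadialLogVolume`).
[claim: Mochizuki2012, status: disputed] -/
theorem isCompact_arcLogShell : IsCompact arcLogShell := by
  rw [arcLogShell_eq_complexLogShell, ComplexLogShell.logShell_eq_closedBall]
  exact isCompact_closedBall 0 π

/-- **IUTchIII:Prop1.2(v)** (kurims p.32) (b^{arc}) "`I_{†F_v}` contains `Ψ_{log(†F_v)}`" (`O_k ⊆ I_k`).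
[claim: Mochizuki2012, status: disputed] -/
theorem arcIntegers_subset_complexLogShell : arcIntegers ⊆ ComplexLogShell.logShell :=
  arcLogShell_eq_complexLogShell ▸ arcIntegers_subset_arcLogShell

/-- **IUTchIII:Prop1.2(v)** (kurims p.32) (c^{arc}) "the image of `I_{†F_v}` in `Ψ^{gp}_{†F_v}` contains `Ψ^×_{†F_v}`
[i.e., in essence, the pre-log-shell]" (`O_k^× ⊆ exp_k(I_k)`). [claim: Mochizuki2012, status: disputed] -/
theorem sphere_subset_exp_complexLogShell : sphere (0 : ℂ) 1 ⊆ Complex.exp '' ComplexLogShell.logShell := by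
  rw [← arcLogShell_eq_complexLogShell]
  intro a ha
  exact arcUnits_subset_exp_arcLogShell (by simpa [arcUnits, mem_sphere, dist_zero_right] using ha)

end Literature.IUT.LogThetaLattice
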